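import Mathlib
import HarnessLib
import Summits.CriticalPhenomena.PercolationContinuityZ3.Theses.PercLowPointHalfSpace
import Literature.Probability.Percolation.HalfSpacePinnedPairs

/-!
# Sketch — crux-ideate stmt-CriticalPhenomena-0911 (BoundaryTwoArmDecay), ideator 1, round 1

First lemmas of the line `level-coalescent-merge-counting` (idea card), stated over existing
declarations. Nothing is proved here; the point is that the TRANSFER TARGETS elaborate.
-/

noncomputable section

namespace Summit.CriticalPhenomena.PercolationContinuityZ3.Cruxes.BoundaryTwoArmDecay.LevelCoalescent

open MeasureTheory Literature.Probability.Percolation Literature.Probability.LatticeModels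

/-- The critical bond measure on `ℤ³`. -/
abbrev Pc : Measure (BondConfig (Site 3)) := bondPercolation (zdGraph 3) (criticalProbI 3)

/-- The half-space `ℍ = {x₀ ≥ 0}` (written inline in the route file). -/
abbrev Hs : Set (Site 3) := {z : Site 3 | 0 ≤ z 0}

/-- The floor neighbour `e = (0,1,0)` of the origin. -/
abbrev e1 : Site 3 := Pi.single 1 1

/-- `arm_ℍ(x, r)`: the `ℍ`-cluster of `x` reaches sup-distance `≥ r` from `x` (as in the route decl). -/
def armH (x : Site 3) (r : ℕ) : Set (BondConfig (Site 3)) :=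
  {ω | ∃ y : Site 3, (∃ i : Fin 3, (r : ℤ) ≤ |y i - x i|) ∧ ω ∈ openConnIn Hs x y}

/-- The crux event `E_r`: two DISJOINT tall half-space clusters from the adjacent floor roots `0, e`. -/
def twoArm (r : ℕ) : Set (BondConfig (Site 3)) :=
  {ω | ω ∈ armH 0 r ∧ ω ∈ armH e1 r ∧ ω ∉ openConnIn Hs 0 e1}

/-- The open graph of `ω` induced on the half-space. -/
abbrev openH (ω : BondConfig (Site 3)) : SimpleGraph Hs := (openGraph ω).induce Hs

/-- The set of `ℍ`-clusters (connected components of the induced open graph) that contain a FLOOR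
point `x` (`x₀ = 0`) of the window `‖x‖∞ ≤ r` whose `ℍ`-cluster is `r`-tall: the distinct tall
half-space clusters standing on the floor window. -/
def tallFloorClusters (r : ℕ) (ω : BondConfig (Site 3)) : Set (openH ω).ConnectedComponent :=
  {C | ∃ x : Site 3, ∃ hx : x ∈ Hs, x 0 = 0 ∧ (∀ i : Fin 3, |x i| ≤ (r : ℤ)) ∧ ω ∈ armH x r ∧
      (openH ω).connectedComponentMk ⟨x, hx⟩ = C}

/-- `N_ℍ(r)`: the number of distinct `r`-tall half-space clusters touching the floor window. -/
def tallFloorClusterCount (r : ℕ) (ω : BondConfig (Site 3)) : ℕ∞ := (tallFloorClusters r ω).encard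

/-- TRANSFER TARGET 1 (`σ_ℍ < 1/2`): **half-space tall-cluster sparsity** — the expected number of
distinct `r`-tall half-space clusters standing on an `r`-window of the floor grows slower than `√r`.
(Prediction: `O(1)` = hyperscaling/tightness in `ℍ`; trivial bound `r^{2-a₁}`; in 2D a theorem by RSW.) -/
def HalfSpaceTallClusterSparsity : Prop :=
  ∃ σ C : ℝ, σ < 1 / 2 ∧ 0 ≤ σ ∧ ∀ r : ℕ, 1 ≤ r →
    ∫⁻ ω, ((tallFloorClusterCount r ω : ℕ∞) : ENNReal) ∂Pc ≤ ENNReal.ofReal (C * (r : ℝ) ^ σ)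

/-- The same target in MASS-TRANSPORT form (re-rooting at the lex-min floor point, LyonsPeres2016 §8):
`E[ 1{arm_ℍ(0,r)} / |U ∩ ∂ℍ| ] ≤ C r^{-(3/2+κ)}`, `U = C_ℍ(0)`, footprint `halfSpaceFootprint`
(exists in `HalfSpacePinnedPairs.lean`). Equivalent to sparsity up to constants and `r ↔ 2r`. -/
def FootprintSparsity : Prop :=
  ∃ κ C : ℝ, 0 < κ ∧ ∀ r : ℕ, 1 ≤ r →
    ∫⁻ ω, (armH 0 r).indicator (fun _ => (1 : ENNReal)) ω /
        ((halfSpaceFootprint ω : ℕ∞) : ENNReal) ∂Pc ≤ ENNReal.ofReal (C * (r : ℝ) ^ (-(3 / 2 + κ)))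

/-- The floor-adjacency MULTIPLICITY of the two root clusters: the number of floor points `v` with
`v ∈ C_ℍ(0)` and `v + e ∈ C_ℍ(e)` (on `E_r` these are the other adjacent root pairs of the same two
clusters; `v = 0` always counts). -/
def adjMultiplicity (ω : BondConfig (Site 3)) : ℕ∞ :=
  {v : Site 3 | v 0 = 0 ∧ ω ∈ openConnIn Hs 0 v ∧ ω ∈ openConnIn Hs e1 (v + e1)}.encard

/-- TRANSFER TARGET 2 (`μ`): **adjacency multiplicity** — conditionally on the crux event, the two
disjoint tall clusters have few other floor-adjacent root pairs, in `L¹`: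
`E[m ; E_r] ≤ C r^μ P(E_r)`. (Prediction `μ = 0`; needed: `σ + μ < 1/2`.) -/
def AdjacencyMultiplicity (μ : ℝ) : Prop :=
  ∃ C : ℝ, ∀ r : ℕ, 1 ≤ r →
    ∫⁻ ω, (twoArm r).indicator (fun ω => ((adjMultiplicity ω : ℕ∞) : ENNReal)) ω ∂Pc
      ≤ ENNReal.ofReal (C * (r : ℝ) ^ μ) * Pc (twoArm r)

/-- FIRST LEMMA of the line (the level-coalescent transfer, to be proved by merge counting in the
level filtration `F_l = σ(edges of {x₀ ≥ l})`, fresh layers, births ≤ floor-touching tall counts):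
sparsity with exponent `σ` and multiplicity with exponent `μ`, `σ + μ < 1/2`, imply the crux
`BoundaryTwoArmDecay` (with `κ = 1/2 - σ - μ`, up to the `r ↔ 2r` averaging). -/
def LevelCoalescentTransfer : Prop :=
  ∀ σ μ : ℝ, σ + μ < 1 / 2 →
    (∃ C : ℝ, ∀ r : ℕ, 1 ≤ r →
      ∫⁻ ω, ((tallFloorClusterCount r ω : ℕ∞) : ENNReal) ∂Pc ≤ ENNReal.ofReal (C * (r : ℝ) ^ σ)) →
    AdjacencyMultiplicity μ →
    Summit.CriticalPhenomena.PercolationContinuityZ3.Theses.PercLowPointHalfSpace.BoundaryTwoArmDecay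

/-- Sanity: the crux event of this sketch is literally the route's event (same shape). -/
example (r : ℕ) (ω : BondConfig (Site 3)) :
    ω ∈ twoArm r ↔
      ((∃ y : Site 3, (∃ i : Fin 3, (r : ℤ) ≤ |y i - (0 : Site 3) i|) ∧ ω ∈ openConnIn Hs 0 y) ∧
       (∃ y : Site 3, (∃ i : Fin 3, (r : ℤ) ≤ |y i - e1 i|) ∧ ω ∈ openConnIn Hs e1 y) ∧
       ω ∉ openConnIn Hs 0 e1) := by
  simp [twoArm, armH]


/-! ### Line `exploration-decoupled-avoidance` (skeleton (a): the only one whose dream value clears 5/2) -/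

/-- The `ℍ`-cluster of the origin as a vertex set. -/
def clusterH (ω : BondConfig (Site 3)) : Set (Site 3) := {v | ω ∈ openConnIn Hs 0 v}

/-- `arm` of `e` to sup-distance `r` inside a sub-domain `D ⊆ ℍ` (cluster grown using only vertices of `D`). -/
def armIn (D : Set (Site 3)) (x : Site 3) (r : ℕ) : Set (BondConfig (Site 3)) :=
  {ω | ∃ y : Site 3, (∃ i : Fin 3, (r : ℤ) ≤ |y i - x i|) ∧ ω ∈ openConnIn D x y}

/-- FIRST LEMMA (provable now; exploration / stopping-set decoupling): conditionally on the cluster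
`A = C_ℍ(0)`, the cluster of `e` avoiding `A` is Bernoulli percolation on the induced graph `ℍ ∖ A` with FRESH
randomness, so `P(E_r) = ∫ 1{A tall} 1{e ∉ A} · P(arm of e to r in ℍ ∖ A(ω)) dP(ω)`. -/
def DecouplingIdentity : Prop :=
  ∀ r : ℕ, 1 ≤ r →
    Pc (twoArm r) =
      ∫⁻ ω, (armH 0 r).indicator (fun _ => (1 : ENNReal)) ω *
            ({ω' : BondConfig (Site 3) | e1 ∉ clusterH ω'}).indicator (fun _ => (1 : ENNReal)) ω *
            Pc (armIn (Hs \ clusterH ω) e1 r) ∂Pc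

/-- STUB S1 (`a₀`): boundary one-arm RATE — crux C of the route in quantified form. -/
def BoundaryOneArmRate (a : ℝ) : Prop :=
  ∃ C : ℝ, ∀ r : ℕ, 1 ≤ r → Pc.real (armH 0 r) ≤ C * (r : ℝ) ^ (-a)

/-- STUB S2 (`λ₀`): CONDITIONAL REPULSION beyond BK/Reimer — by `DecouplingIdentity` this says that for
`P`-typical tall `A = C_ℍ(0)` the random domain `ℍ ∖ A` has a boundary-arm DEFICIENCY `r^{-λ₀}` at `e`. -/
def ConditionalRepulsion (lam : ℝ) : Prop :=
  ∃ C : ℝ, ∀ r : ℕ, 1 ≤ r →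
    Pc.real (twoArm r) ≤ C * (r : ℝ) ^ (-lam) * (Pc.real (armH 0 r)) ^ 2

/-- COMPOSITION (pure exponent algebra, provable now): `2a₀ + λ₀ > 5/2` closes the crux. -/
def AvoidanceSplit : Prop :=
  ∀ a lam : ℝ, 5 / 2 < 2 * a + lam → BoundaryOneArmRate a → ConditionalRepulsion lam →
    Summit.CriticalPhenomena.PercolationContinuityZ3.Theses.PercLowPointHalfSpace.BoundaryTwoArmDecay

/-- The exact LOWER companion (same decoupling, `armIn (ℍ∖A) ⊇ {C_ℍ(e) tall ∧ C_ℍ(e) ∩ A = ∅}`):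
`P(E_r) ≥ P ⊗ P(A ∩ B = ∅, both tall)` for INDEPENDENT `A = C_ℍ(0)[ω]`, `B = C_ℍ(e)[ω']`. -/
def IndependentDisjointLowerBound : Prop :=
  ∀ r : ℕ, 1 ≤ r →
    (Pc.prod Pc) {q : BondConfig (Site 3) × BondConfig (Site 3) |
        q.1 ∈ armH 0 r ∧ q.2 ∈ armH e1 r ∧
        Disjoint (clusterH q.1) {v | q.2 ∈ openConnIn Hs e1 v}} ≤ Pc (twoArm r)

end Summit.CriticalPhenomena.PercolationContinuityZ3.Cruxes.BoundaryTwoArmDecay.LevelCoalescent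

end
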